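import Summits.NavierStokesRegularity.OSWSelfSimilar.SheetREnergyClass
import HarnessLib

/-!
# SHEET-ℝ frame, PRICE (C4) at function level: the trilinear bound for the quadratic part `Q u v = a·𝒰u·v′ − (Hu)·v` on the
# whole energy class

HONEST FRAMING (cell ns-blowup GROUP B / zone Z3, case Z3-SR-CERT; 1-D MODEL certificate frame (viscous gCLM/OSW on the line); not Euler/NS;
«violates: none — MODEL»). Nothing here asserts that a profile exists.

The certificate's map is `G(Ω) = g₀ + AΩ + Q Ω Ω` with the quadratic part `Q u v = a·𝒰u·v′ − (Hu)·v` (`𝒰u = ∫₀ Hu`, `H = hilbertTransform`),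
paired against test functions through `⟨f, wφ⟩ = ∫ w f φ`, `w = L² + ξ²`.  PRICE-impl1 (C4) / cert-2's `existsUnique_zero_of_row_quadratic` ask for
ONE bilinear estimate `‖Q u v‖_{X*} ≤ M‖u‖_E‖v‖_E`, `M = 2[2√2/L + 2a(π/(4L))^{1/2}]`, `L_lip = 2M`.  This file proves its FUNCTION-LEVEL form
on the whole energy class (elements written as primitives `u = u(0) + ∫₀u₁`, `v = v(0) + ∫₀v₁` with weighted `L²` data, `u` odd; `φ ∈ L²_w`):

  `|∫ w·(a·𝒰u·v₁ − Hu·v)·φ| ≤ (2|a|(π/(4L))^{1/2} + 2√2/L)·‖u‖_E·‖v‖_E·‖φ‖_w`     (`abs_pairing_quadratic_le`)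

(`‖u‖²_E = ∫ w(u₁² + ¼u²)`, `‖φ‖²_w = ∫ wφ²`), hence with `‖φ‖_w ≤ 2‖φ‖_E` the constant `M` above (`abs_pairing_quadratic_le_energy`).
Ingredients, all on the whole class (`SheetREnergyClass`): `|𝒰u| ≤ (π/(4L))^{1/2}‖u‖_w`, `‖Hu‖_w = ‖u‖_w`, `sup|v| ≤ √2‖v‖_E/L`, weighted
Cauchy–Schwarz, `‖u‖_w ≤ 2‖u‖_E`, `‖v₁‖_w ≤ ‖v‖_E`.  Pure calculus; no definition, no named fact.  WHAT THIS IS NOT: not NS; not the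
Hilbert-space packaging (the operator-norm sentence `‖Q u v‖_{E*} ≤ M‖u‖‖v‖` follows from this bound once `E`, `E*` are instantiated — that
instantiation is the MODEL ASSEMBLY, not done here).
-/

noncomputable section

namespace Summit.NavierStokesRegularity.OSWSelfSimilar
namespace SheetREnergyClass

open _root_.MeasureTheory _root_.Set _root_.Filter _root_.Function Literature.Analysis.Fourier
  SheetRWeakProfilePV SheetRWeakToStrong
open scoped Real Topology

/-- `‖Ω‖_w ≤ 2‖Ω‖_E` and `‖Ω₁‖_w ≤ ‖Ω‖_E` (square-root forms), from `∫wΩ² = 4∫w·¼Ω² ≤ 4‖Ω‖²_E`, `∫wΩ₁² ≤ ‖Ω‖²_E`. [folklore] -/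
theorem sqrt_weightedSq_le_energy {Ω Ω₁ : ℝ → ℝ} {L : ℝ} (h0 : Integrable fun y => (L ^ 2 + y ^ 2) * Ω y ^ 2)
    (h1 : Integrable fun y => (L ^ 2 + y ^ 2) * Ω₁ y ^ 2) :
    Real.sqrt (∫ y, (L ^ 2 + y ^ 2) * Ω y ^ 2) ≤ 2 * Real.sqrt (∫ y, (L ^ 2 + y ^ 2) * (Ω₁ y ^ 2 + 1 / 4 * Ω y ^ 2)) ∧
      Real.sqrt (∫ y, (L ^ 2 + y ^ 2) * Ω₁ y ^ 2) ≤ Real.sqrt (∫ y, (L ^ 2 + y ^ 2) * (Ω₁ y ^ 2 + 1 / 4 * Ω y ^ 2)) := by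
  have hE : Integrable fun y => (L ^ 2 + y ^ 2) * (Ω₁ y ^ 2 + 1 / 4 * Ω y ^ 2) := by
    refine (h1.add (h0.div_const 4)).congr (Eventually.of_forall fun y => ?_)
    simp only [Pi.add_apply]
    ring
  have hE0 : 0 ≤ ∫ y, (L ^ 2 + y ^ 2) * (Ω₁ y ^ 2 + 1 / 4 * Ω y ^ 2) := integral_nonneg fun y => by positivity
  have hle0 : ∫ y, (L ^ 2 + y ^ 2) * Ω y ^ 2 ≤ 4 * ∫ y, (L ^ 2 + y ^ 2) * (Ω₁ y ^ 2 + 1 / 4 * Ω y ^ 2) := by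
    rw [← integral_const_mul]
    refine integral_mono h0 (hE.const_mul 4) fun y => ?_
    have hw : 0 ≤ L ^ 2 + y ^ 2 := by positivity
    nlinarith [mul_nonneg hw (sq_nonneg (Ω₁ y))]
  have hle1 : ∫ y, (L ^ 2 + y ^ 2) * Ω₁ y ^ 2 ≤ ∫ y, (L ^ 2 + y ^ 2) * (Ω₁ y ^ 2 + 1 / 4 * Ω y ^ 2) := by
    refine integral_mono h1 hE fun y => ?_
    have hw : 0 ≤ L ^ 2 + y ^ 2 := by positivity
    nlinarith [mul_nonneg hw (sq_nonneg (Ω y))]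
  refine ⟨?_, Real.sqrt_le_sqrt hle1⟩
  have h4 : Real.sqrt 4 = 2 := by
    rw [show (4 : ℝ) = 2 ^ 2 by norm_num]; exact Real.sqrt_sq (by norm_num)
  calc Real.sqrt (∫ y, (L ^ 2 + y ^ 2) * Ω y ^ 2) ≤ Real.sqrt (4 * ∫ y, (L ^ 2 + y ^ 2) * (Ω₁ y ^ 2 + 1 / 4 * Ω y ^ 2)) :=
        Real.sqrt_le_sqrt hle0
    _ = 2 * Real.sqrt (∫ y, (L ^ 2 + y ^ 2) * (Ω₁ y ^ 2 + 1 / 4 * Ω y ^ 2)) := by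
        rw [Real.sqrt_mul (by norm_num : (0:ℝ) ≤ 4), h4]

/-- **PRICE (C4) at function level.** For an ODD `H¹`-type `u = u(0) + ∫₀u₁`, an `H¹`-type `v = v(0) + ∫₀v₁` (weighted `L²` data,
`w = L² + ξ²`, `L > 0`) and `φ` with `∫wφ² < ∞`:  the pairing `⟨Q u v, wφ⟩ = ∫ w·(a·𝒰u·v₁ − Hu·v)·φ` is absolutely convergent and
`|∫ w·(a·(∫₀^ξ Hu)·v₁ − Hu·v)·φ| ≤ (2|a|(π/(4L))^{1/2} + 2√2/L)·‖u‖_E·‖v‖_E·‖φ‖_w`. MODEL frame bookkeeping. [folklore] -/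
theorem abs_pairing_quadratic_le {u u₁ v v₁ φ : ℝ → ℝ} {L a : ℝ} (hL : 0 < L)
    (hu : ∀ x, u x = u 0 + ∫ s in (0 : ℝ)..x, u₁ s) (hu_odd : ∀ y, u (-y) = -u y) (hu₁m : AEStronglyMeasurable u₁ volume)
    (hwu : Integrable fun y => (L ^ 2 + y ^ 2) * u y ^ 2) (hwu₁ : Integrable fun y => (L ^ 2 + y ^ 2) * u₁ y ^ 2)
    (hv : ∀ x, v x = v 0 + ∫ s in (0 : ℝ)..x, v₁ s) (hv₁m : AEStronglyMeasurable v₁ volume)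
    (hwv : Integrable fun y => (L ^ 2 + y ^ 2) * v y ^ 2) (hwv₁ : Integrable fun y => (L ^ 2 + y ^ 2) * v₁ y ^ 2)
    (hφm : AEStronglyMeasurable φ volume) (hwφ : Integrable fun y => (L ^ 2 + y ^ 2) * φ y ^ 2) :
    Integrable (fun y => (L ^ 2 + y ^ 2) *
        ((a * (∫ s in (0 : ℝ)..y, hilbertTransform u s) * v₁ y - hilbertTransform u y * v y) * φ y)) ∧
      |∫ y, (L ^ 2 + y ^ 2) * ((a * (∫ s in (0 : ℝ)..y, hilbertTransform u s) * v₁ y - hilbertTransform u y * v y) * φ y)|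
        ≤ (2 * |a| * Real.sqrt (π / (4 * L)) + 2 * Real.sqrt 2 / L)
          * Real.sqrt (∫ y, (L ^ 2 + y ^ 2) * (u₁ y ^ 2 + 1 / 4 * u y ^ 2))
          * Real.sqrt (∫ y, (L ^ 2 + y ^ 2) * (v₁ y ^ 2 + 1 / 4 * v y ^ 2))
          * Real.sqrt (∫ y, (L ^ 2 + y ^ 2) * φ y ^ 2) := by
  set H : ℝ → ℝ := hilbertTransform u with hH
  set U : ℝ → ℝ := fun y => ∫ s in (0 : ℝ)..y, H s with hUdef
  -- facts on the whole class
  obtain ⟨_, hu₁2, hu2, hui, -⟩ := basic_of_primitive hL hu hu₁m hwu hwu₁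
  obtain ⟨hvc, _, _, _, -⟩ := basic_of_primitive hL hv hv₁m hwv hwv₁
  obtain ⟨hHm, -, hwH, hiso⟩ := weightedSq_hilbertTransform_of_primitive hL hu hu_odd hu₁m hwu hwu₁
  have hUc : Continuous U := continuous_velocity_of_primitive hu hu₁2 hui hu2
  set sU : ℝ := Real.sqrt (∫ y, (L ^ 2 + y ^ 2) * u y ^ 2) with hsU
  set sV1 : ℝ := Real.sqrt (∫ y, (L ^ 2 + y ^ 2) * v₁ y ^ 2) with hsV1
  set sEU : ℝ := Real.sqrt (∫ y, (L ^ 2 + y ^ 2) * (u₁ y ^ 2 + 1 / 4 * u y ^ 2)) with hsEU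
  set sEV : ℝ := Real.sqrt (∫ y, (L ^ 2 + y ^ 2) * (v₁ y ^ 2 + 1 / 4 * v y ^ 2)) with hsEV
  set sW : ℝ := Real.sqrt (∫ y, (L ^ 2 + y ^ 2) * φ y ^ 2) with hsW
  set P : ℝ := Real.sqrt (π / (4 * L)) with hP
  have hsU0 : 0 ≤ sU := Real.sqrt_nonneg _
  have hsW0 : 0 ≤ sW := Real.sqrt_nonneg _
  have hsEU0 : 0 ≤ sEU := Real.sqrt_nonneg _
  have hsEV0 : 0 ≤ sEV := Real.sqrt_nonneg _
  have hP0 : 0 ≤ P := Real.sqrt_nonneg _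
  -- sup bounds: |U| ≤ P·sU, |v| ≤ (√2/L)·sEV
  have hU : ∀ y, |U y| ≤ P * sU := fun y => abs_velocity_le_of_primitive hL hu hu_odd hu₁m hwu hwu₁ y
  have hV : ∀ y, |v y| ≤ Real.sqrt 2 / L * sEV := fun y =>
    abs_le_sqrt_two_div_mul_energy_of_primitive hL hv hv₁m hwv hwv₁ y
  have hCU0 : 0 ≤ P * sU := mul_nonneg hP0 hsU0
  have hCV0 : 0 ≤ Real.sqrt 2 / L * sEV := by positivity
  -- weighted Cauchy–Schwarz instances
  obtain ⟨hi1, hcs1⟩ := integral_weight_abs_mul_le (L := L) hv₁m hφm hwv₁ hwφ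
  obtain ⟨hi2, hcs2⟩ := integral_weight_abs_mul_le (L := L) hHm hφm hwH hwφ
  have hsH : Real.sqrt (∫ y, (L ^ 2 + y ^ 2) * H y ^ 2) = sU := by rw [hsU, ← hiso]
  -- energy comparisons
  obtain ⟨hsU_le, -⟩ := sqrt_weightedSq_le_energy hwu hwu₁
  obtain ⟨-, hsV1_le⟩ := sqrt_weightedSq_le_energy hwv hwv₁
  -- term 1: A y = w·(a·U·v₁·φ)
  have hwm : AEStronglyMeasurable (fun y : ℝ => L ^ 2 + y ^ 2) volume := by fun_prop
  have hAm : AEStronglyMeasurable (fun y => (L ^ 2 + y ^ 2) * (a * U y * v₁ y * φ y)) volume :=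
    hwm.mul (((hUc.aestronglyMeasurable.const_mul a).mul hv₁m).mul hφm)
  have hApt : ∀ y, |(L ^ 2 + y ^ 2) * (a * U y * v₁ y * φ y)| ≤ |a| * (P * sU) * ((L ^ 2 + y ^ 2) * |v₁ y * φ y|) := by
    intro y
    have hw : 0 ≤ L ^ 2 + y ^ 2 := by positivity
    rw [abs_mul, abs_of_nonneg hw, show a * U y * v₁ y * φ y = (a * U y) * (v₁ y * φ y) by ring, abs_mul, abs_mul]
    have h1 : |a| * |U y| ≤ |a| * (P * sU) := mul_le_mul_of_nonneg_left (hU y) (abs_nonneg a)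
    have h2 : 0 ≤ |v₁ y * φ y| := abs_nonneg _
    nlinarith [mul_le_mul_of_nonneg_right h1 (mul_nonneg hw h2)]
  have hAi : Integrable (fun y => (L ^ 2 + y ^ 2) * (a * U y * v₁ y * φ y)) :=
    (hi1.const_mul (|a| * (P * sU))).mono' hAm (Eventually.of_forall fun y => by rw [Real.norm_eq_abs]; exact hApt y)
  have hAbd : |∫ y, (L ^ 2 + y ^ 2) * (a * U y * v₁ y * φ y)| ≤ |a| * (P * sU) * (sV1 * sW) := by
    calc |∫ y, (L ^ 2 + y ^ 2) * (a * U y * v₁ y * φ y)| ≤ ∫ y, |(L ^ 2 + y ^ 2) * (a * U y * v₁ y * φ y)| :=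
          abs_integral_le_integral_abs
      _ ≤ ∫ y, |a| * (P * sU) * ((L ^ 2 + y ^ 2) * |v₁ y * φ y|) := integral_mono hAi.abs (hi1.const_mul _) hApt
      _ = |a| * (P * sU) * ∫ y, (L ^ 2 + y ^ 2) * |v₁ y * φ y| := integral_const_mul _ _
      _ ≤ |a| * (P * sU) * (sV1 * sW) := mul_le_mul_of_nonneg_left hcs1 (mul_nonneg (abs_nonneg a) hCU0)
  -- term 2: B y = w·(H·v·φ)
  have hBm : AEStronglyMeasurable (fun y => (L ^ 2 + y ^ 2) * (H y * v y * φ y)) volume :=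
    hwm.mul ((hHm.mul hvc.aestronglyMeasurable).mul hφm)
  have hBpt : ∀ y, |(L ^ 2 + y ^ 2) * (H y * v y * φ y)| ≤ Real.sqrt 2 / L * sEV * ((L ^ 2 + y ^ 2) * |H y * φ y|) := by
    intro y
    have hw : 0 ≤ L ^ 2 + y ^ 2 := by positivity
    rw [abs_mul, abs_of_nonneg hw, show H y * v y * φ y = v y * (H y * φ y) by ring, abs_mul]
    have h2 : 0 ≤ |H y * φ y| := abs_nonneg _
    nlinarith [mul_le_mul_of_nonneg_right (hV y) (mul_nonneg hw h2)]
  have hBi : Integrable (fun y => (L ^ 2 + y ^ 2) * (H y * v y * φ y)) :=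
    (hi2.const_mul (Real.sqrt 2 / L * sEV)).mono' hBm (Eventually.of_forall fun y => by rw [Real.norm_eq_abs]; exact hBpt y)
  have hBbd : |∫ y, (L ^ 2 + y ^ 2) * (H y * v y * φ y)| ≤ Real.sqrt 2 / L * sEV * (sU * sW) := by
    calc |∫ y, (L ^ 2 + y ^ 2) * (H y * v y * φ y)| ≤ ∫ y, |(L ^ 2 + y ^ 2) * (H y * v y * φ y)| :=
          abs_integral_le_integral_abs
      _ ≤ ∫ y, Real.sqrt 2 / L * sEV * ((L ^ 2 + y ^ 2) * |H y * φ y|) := integral_mono hBi.abs (hi2.const_mul _) hBpt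
      _ = Real.sqrt 2 / L * sEV * ∫ y, (L ^ 2 + y ^ 2) * |H y * φ y| := integral_const_mul _ _
      _ ≤ Real.sqrt 2 / L * sEV * (sU * sW) := by
          refine mul_le_mul_of_nonneg_left ?_ hCV0
          rw [← hsH]; exact hcs2
  -- the pairing integrand is `A − B`
  have hsplit : (fun y => (L ^ 2 + y ^ 2) * ((a * U y * v₁ y - H y * v y) * φ y))
      = fun y => (L ^ 2 + y ^ 2) * (a * U y * v₁ y * φ y) - (L ^ 2 + y ^ 2) * (H y * v y * φ y) := by
    funext y; ring
  refine ⟨by rw [hsplit]; exact hAi.sub hBi, ?_⟩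
  rw [hsplit, integral_sub hAi hBi]
  -- numeric assembly
  have hA' : |∫ y, (L ^ 2 + y ^ 2) * (a * U y * v₁ y * φ y)| ≤ 2 * |a| * P * sEU * sEV * sW := by
    calc |∫ y, (L ^ 2 + y ^ 2) * (a * U y * v₁ y * φ y)| ≤ |a| * (P * sU) * (sV1 * sW) := hAbd
      _ ≤ |a| * (P * (2 * sEU)) * (sEV * sW) := by gcongr
      _ = 2 * |a| * P * sEU * sEV * sW := by ring
  have hB' : |∫ y, (L ^ 2 + y ^ 2) * (H y * v y * φ y)| ≤ 2 * (Real.sqrt 2 / L) * sEU * sEV * sW := by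
    calc |∫ y, (L ^ 2 + y ^ 2) * (H y * v y * φ y)| ≤ Real.sqrt 2 / L * sEV * (sU * sW) := hBbd
      _ ≤ Real.sqrt 2 / L * sEV * ((2 * sEU) * sW) := by gcongr
      _ = 2 * (Real.sqrt 2 / L) * sEU * sEV * sW := by ring
  have e : (2 * |a| * P + 2 * Real.sqrt 2 / L) * sEU * sEV * sW
      = 2 * |a| * P * sEU * sEV * sW + 2 * (Real.sqrt 2 / L) * sEU * sEV * sW := by ring
  rw [e]
  exact (abs_sub _ _).trans (add_le_add hA' hB')

/-- **PRICE (C4)'s constant.** With `‖φ‖_w ≤ 2‖φ‖_E` for `φ` in the energy class: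
`|⟨Q u v, wφ⟩| ≤ M·‖u‖_E·‖v‖_E·‖φ‖_E`, `M = 2·(2√2/L + 2|a|(π/(4L))^{1/2})` (PRICE-impl1 (C4): `L_lip = 2M`). MODEL frame bookkeeping. [folklore] -/
theorem abs_pairing_quadratic_le_energy {u u₁ v v₁ φ φ₁ : ℝ → ℝ} {L a : ℝ} (hL : 0 < L)
    (hu : ∀ x, u x = u 0 + ∫ s in (0 : ℝ)..x, u₁ s) (hu_odd : ∀ y, u (-y) = -u y) (hu₁m : AEStronglyMeasurable u₁ volume)
    (hwu : Integrable fun y => (L ^ 2 + y ^ 2) * u y ^ 2) (hwu₁ : Integrable fun y => (L ^ 2 + y ^ 2) * u₁ y ^ 2)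
    (hv : ∀ x, v x = v 0 + ∫ s in (0 : ℝ)..x, v₁ s) (hv₁m : AEStronglyMeasurable v₁ volume)
    (hwv : Integrable fun y => (L ^ 2 + y ^ 2) * v y ^ 2) (hwv₁ : Integrable fun y => (L ^ 2 + y ^ 2) * v₁ y ^ 2)
    (hφm : AEStronglyMeasurable φ volume) (hwφ : Integrable fun y => (L ^ 2 + y ^ 2) * φ y ^ 2)
    (hwφ₁ : Integrable fun y => (L ^ 2 + y ^ 2) * φ₁ y ^ 2) :
    |∫ y, (L ^ 2 + y ^ 2) * ((a * (∫ s in (0 : ℝ)..y, hilbertTransform u s) * v₁ y - hilbertTransform u y * v y) * φ y)|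
      ≤ 2 * (2 * Real.sqrt 2 / L + 2 * |a| * Real.sqrt (π / (4 * L)))
        * Real.sqrt (∫ y, (L ^ 2 + y ^ 2) * (u₁ y ^ 2 + 1 / 4 * u y ^ 2))
        * Real.sqrt (∫ y, (L ^ 2 + y ^ 2) * (v₁ y ^ 2 + 1 / 4 * v y ^ 2))
        * Real.sqrt (∫ y, (L ^ 2 + y ^ 2) * (φ₁ y ^ 2 + 1 / 4 * φ y ^ 2)) := by
  obtain ⟨-, h⟩ := abs_pairing_quadratic_le hL hu hu_odd hu₁m hwu hwu₁ hv hv₁m hwv hwv₁ hφm hwφ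
  obtain ⟨hφle, -⟩ := sqrt_weightedSq_le_energy hwφ hwφ₁
  have hK0 : 0 ≤ (2 * |a| * Real.sqrt (π / (4 * L)) + 2 * Real.sqrt 2 / L)
      * Real.sqrt (∫ y, (L ^ 2 + y ^ 2) * (u₁ y ^ 2 + 1 / 4 * u y ^ 2))
      * Real.sqrt (∫ y, (L ^ 2 + y ^ 2) * (v₁ y ^ 2 + 1 / 4 * v y ^ 2)) := by positivity
  calc _ ≤ _ := h
    _ ≤ (2 * |a| * Real.sqrt (π / (4 * L)) + 2 * Real.sqrt 2 / L)
        * Real.sqrt (∫ y, (L ^ 2 + y ^ 2) * (u₁ y ^ 2 + 1 / 4 * u y ^ 2))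
        * Real.sqrt (∫ y, (L ^ 2 + y ^ 2) * (v₁ y ^ 2 + 1 / 4 * v y ^ 2))
        * (2 * Real.sqrt (∫ y, (L ^ 2 + y ^ 2) * (φ₁ y ^ 2 + 1 / 4 * φ y ^ 2))) :=
        mul_le_mul_of_nonneg_left hφle hK0
    _ = _ := by ring


/-! ### Append (selfsim g9, same session): the quadratic part as a map into the WEIGHTED `L²` space — `‖a𝒰u·v₁ − Hu·v‖_w ≤ (M/2)‖u‖_E‖v‖_E`

Companion of `CertificateViscousSheetR.existsUnique_fixedPoint_of_row_w` (pivot space `L²_w`, hypothesis `4M_w ≤ Llip`): at function level the quadratic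
part maps `E × E` into `L²_w` with constant `M_w = M/2 = 2√2/L + 2|a|(π/(4L))^{1/2}` — the pairing bound `abs_pairing_quadratic_le` loses exactly the
factor `‖φ‖_w ≤ 2‖φ‖_E`.  Weighted Minkowski from the weighted Cauchy–Schwarz of `SheetREnergyClass`. -/

/-- **Weighted Minkowski.** For a.e.-strongly measurable `f, g` with `∫wf² < ∞`, `∫wg² < ∞` (`w = L² + y²`): `∫w(f − g)² < ∞` and
`(∫w(f−g)²)^{1/2} ≤ (∫wf²)^{1/2} + (∫wg²)^{1/2}`. [folklore] -/
theorem sqrt_weightedSq_sub_le {L : ℝ} {f g : ℝ → ℝ} (hfm : AEStronglyMeasurable f volume) (hgm : AEStronglyMeasurable g volume)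
    (hf : Integrable fun y => (L ^ 2 + y ^ 2) * f y ^ 2) (hg : Integrable fun y => (L ^ 2 + y ^ 2) * g y ^ 2) :
    Integrable (fun y => (L ^ 2 + y ^ 2) * (f y - g y) ^ 2) ∧
      Real.sqrt (∫ y, (L ^ 2 + y ^ 2) * (f y - g y) ^ 2) ≤
        Real.sqrt (∫ y, (L ^ 2 + y ^ 2) * f y ^ 2) + Real.sqrt (∫ y, (L ^ 2 + y ^ 2) * g y ^ 2) := by
  obtain ⟨hfg, hcs⟩ := integral_weight_abs_mul_le (L := L) hfm hgm hf hg
  set A : ℝ := ∫ y, (L ^ 2 + y ^ 2) * f y ^ 2 with hA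
  set B : ℝ := ∫ y, (L ^ 2 + y ^ 2) * g y ^ 2 with hB
  have hA0 : 0 ≤ A := integral_nonneg fun y => by positivity
  have hB0 : 0 ≤ B := integral_nonneg fun y => by positivity
  have hwm : AEStronglyMeasurable (fun y : ℝ => L ^ 2 + y ^ 2) volume := by fun_prop
  have hint : Integrable (fun y => (L ^ 2 + y ^ 2) * (f y - g y) ^ 2) := by
    have h2 : Integrable fun y => (L ^ 2 + y ^ 2) * (f y * g y) :=
      hfg.mono' (hwm.mul (hfm.mul hgm)) (Eventually.of_forall fun y => by
        rw [Real.norm_eq_abs, abs_mul, abs_of_nonneg (by positivity : (0:ℝ) ≤ L ^ 2 + y ^ 2)])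
    refine ((hf.sub (h2.const_mul 2)).add hg).congr (Eventually.of_forall fun y => ?_)
    simp only [Pi.add_apply, Pi.sub_apply]
    ring
  refine ⟨hint, ?_⟩
  have hexp : ∫ y, (L ^ 2 + y ^ 2) * (f y - g y) ^ 2 ≤ (Real.sqrt A + Real.sqrt B) ^ 2 := by
    have h2 : Integrable fun y => (L ^ 2 + y ^ 2) * (f y * g y) :=
      hfg.mono' (hwm.mul (hfm.mul hgm)) (Eventually.of_forall fun y => by
        rw [Real.norm_eq_abs, abs_mul, abs_of_nonneg (by positivity : (0:ℝ) ≤ L ^ 2 + y ^ 2)])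
    have e : ∫ y, (L ^ 2 + y ^ 2) * (f y - g y) ^ 2 = A - 2 * (∫ y, (L ^ 2 + y ^ 2) * (f y * g y)) + B := by
      have h3 : (fun y => (L ^ 2 + y ^ 2) * (f y - g y) ^ 2)
          = fun y => ((L ^ 2 + y ^ 2) * f y ^ 2 - 2 * ((L ^ 2 + y ^ 2) * (f y * g y))) + (L ^ 2 + y ^ 2) * g y ^ 2 := by
        funext y; ring
      have hi : Integrable fun y => (L ^ 2 + y ^ 2) * f y ^ 2 - 2 * ((L ^ 2 + y ^ 2) * (f y * g y)) := hf.sub (h2.const_mul 2)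
      rw [h3, integral_add hi hg, integral_sub hf (h2.const_mul 2), integral_const_mul]
    have hcross : |∫ y, (L ^ 2 + y ^ 2) * (f y * g y)| ≤ Real.sqrt A * Real.sqrt B := by
      calc |∫ y, (L ^ 2 + y ^ 2) * (f y * g y)| ≤ ∫ y, |(L ^ 2 + y ^ 2) * (f y * g y)| := abs_integral_le_integral_abs
        _ = ∫ y, (L ^ 2 + y ^ 2) * |f y * g y| :=
            integral_congr_ae (Eventually.of_forall fun y => by
              show |(L ^ 2 + y ^ 2) * (f y * g y)| = (L ^ 2 + y ^ 2) * |f y * g y|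
              rw [abs_mul, abs_of_nonneg (by positivity : (0:ℝ) ≤ L ^ 2 + y ^ 2)])
        _ ≤ Real.sqrt A * Real.sqrt B := hcs
    rw [e, add_sq, Real.sq_sqrt hA0, Real.sq_sqrt hB0]
    nlinarith [neg_abs_le (∫ y, (L ^ 2 + y ^ 2) * (f y * g y))]
  calc Real.sqrt (∫ y, (L ^ 2 + y ^ 2) * (f y - g y) ^ 2) ≤ Real.sqrt ((Real.sqrt A + Real.sqrt B) ^ 2) := Real.sqrt_le_sqrt hexp
    _ = Real.sqrt A + Real.sqrt B := Real.sqrt_sq (by positivity)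

/-- **The quadratic part maps into `L²_w` with constant `M/2`.** For an ODD `H¹`-type `u`, an `H¹`-type `v` (weighted `L²` data, `L > 0`):
`w·(a·𝒰u·v₁ − Hu·v)² ∈ L¹` and `(∫ w(a·(∫₀^ξHu)·v₁ − Hu·v)²)^{1/2} ≤ (2|a|(π/(4L))^{1/2} + 2√2/L)·‖u‖_E·‖v‖_E` (`= (M/2)‖u‖_E‖v‖_E`,
`M = 2[2√2/L + 2|a|(π/(4L))^{1/2}]`, PRICE (C4)). MODEL frame bookkeeping. [folklore] -/
theorem sqrt_weightedSq_quadratic_le {u u₁ v v₁ : ℝ → ℝ} {L a : ℝ} (hL : 0 < L)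
    (hu : ∀ x, u x = u 0 + ∫ s in (0 : ℝ)..x, u₁ s) (hu_odd : ∀ y, u (-y) = -u y) (hu₁m : AEStronglyMeasurable u₁ volume)
    (hwu : Integrable fun y => (L ^ 2 + y ^ 2) * u y ^ 2) (hwu₁ : Integrable fun y => (L ^ 2 + y ^ 2) * u₁ y ^ 2)
    (hv : ∀ x, v x = v 0 + ∫ s in (0 : ℝ)..x, v₁ s) (hv₁m : AEStronglyMeasurable v₁ volume)
    (hwv : Integrable fun y => (L ^ 2 + y ^ 2) * v y ^ 2) (hwv₁ : Integrable fun y => (L ^ 2 + y ^ 2) * v₁ y ^ 2) :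
    Integrable (fun y => (L ^ 2 + y ^ 2) *
        (a * (∫ s in (0 : ℝ)..y, hilbertTransform u s) * v₁ y - hilbertTransform u y * v y) ^ 2) ∧
      Real.sqrt (∫ y, (L ^ 2 + y ^ 2) * (a * (∫ s in (0 : ℝ)..y, hilbertTransform u s) * v₁ y - hilbertTransform u y * v y) ^ 2)
        ≤ (2 * |a| * Real.sqrt (π / (4 * L)) + 2 * Real.sqrt 2 / L)
          * Real.sqrt (∫ y, (L ^ 2 + y ^ 2) * (u₁ y ^ 2 + 1 / 4 * u y ^ 2))
          * Real.sqrt (∫ y, (L ^ 2 + y ^ 2) * (v₁ y ^ 2 + 1 / 4 * v y ^ 2)) := by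
  set H : ℝ → ℝ := hilbertTransform u with hH
  set U : ℝ → ℝ := fun y => ∫ s in (0 : ℝ)..y, H s with hUdef
  obtain ⟨_, hu₁2, hu2, hui, -⟩ := basic_of_primitive hL hu hu₁m hwu hwu₁
  obtain ⟨hvc, _, _, _, -⟩ := basic_of_primitive hL hv hv₁m hwv hwv₁
  obtain ⟨hHm, -, hwH, hiso⟩ := weightedSq_hilbertTransform_of_primitive hL hu hu_odd hu₁m hwu hwu₁
  have hUc : Continuous U := continuous_velocity_of_primitive hu hu₁2 hui hu2
  set sU : ℝ := Real.sqrt (∫ y, (L ^ 2 + y ^ 2) * u y ^ 2) with hsU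
  set sV1 : ℝ := Real.sqrt (∫ y, (L ^ 2 + y ^ 2) * v₁ y ^ 2) with hsV1
  set sEU : ℝ := Real.sqrt (∫ y, (L ^ 2 + y ^ 2) * (u₁ y ^ 2 + 1 / 4 * u y ^ 2)) with hsEU
  set sEV : ℝ := Real.sqrt (∫ y, (L ^ 2 + y ^ 2) * (v₁ y ^ 2 + 1 / 4 * v y ^ 2)) with hsEV
  set P : ℝ := Real.sqrt (π / (4 * L)) with hP
  have hsU0 : 0 ≤ sU := Real.sqrt_nonneg _
  have hsEU0 : 0 ≤ sEU := Real.sqrt_nonneg _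
  have hsEV0 : 0 ≤ sEV := Real.sqrt_nonneg _
  have hP0 : 0 ≤ P := Real.sqrt_nonneg _
  have hU : ∀ y, |U y| ≤ P * sU := fun y => abs_velocity_le_of_primitive hL hu hu_odd hu₁m hwu hwu₁ y
  have hV : ∀ y, |v y| ≤ Real.sqrt 2 / L * sEV := fun y =>
    abs_le_sqrt_two_div_mul_energy_of_primitive hL hv hv₁m hwv hwv₁ y
  have hCU0 : 0 ≤ P * sU := mul_nonneg hP0 hsU0
  have hCV0 : 0 ≤ Real.sqrt 2 / L * sEV := by positivity
  obtain ⟨hsU_le, -⟩ := sqrt_weightedSq_le_energy hwu hwu₁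
  obtain ⟨-, hsV1_le⟩ := sqrt_weightedSq_le_energy hwv hwv₁
  -- the two pieces f = a·U·v₁ and g = H·v are in L²_w with the expected constants
  have hfm : AEStronglyMeasurable (fun y => a * U y * v₁ y) volume := (hUc.aestronglyMeasurable.const_mul a).mul hv₁m
  have hgm : AEStronglyMeasurable (fun y => H y * v y) volume := hHm.mul hvc.aestronglyMeasurable
  have hf : Integrable fun y => (L ^ 2 + y ^ 2) * (a * U y * v₁ y) ^ 2 := by
    refine (hwv₁.const_mul ((|a| * (P * sU)) ^ 2)).mono' ((by fun_prop : AEStronglyMeasurable (fun y : ℝ => L ^ 2 + y ^ 2) volume).mul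
      (hfm.pow 2)) (Eventually.of_forall fun y => ?_)
    rw [Real.norm_eq_abs, abs_of_nonneg (by positivity)]
    have h1 : |a * U y| ≤ |a| * (P * sU) := by rw [abs_mul]; exact mul_le_mul_of_nonneg_left (hU y) (abs_nonneg a)
    have h2 : (a * U y) ^ 2 ≤ (|a| * (P * sU)) ^ 2 := by
      rw [← sq_abs (a * U y)]; exact pow_le_pow_left₀ (abs_nonneg _) h1 2
    have hw : 0 ≤ L ^ 2 + y ^ 2 := by positivity
    calc (L ^ 2 + y ^ 2) * (a * U y * v₁ y) ^ 2 = (L ^ 2 + y ^ 2) * v₁ y ^ 2 * (a * U y) ^ 2 := by ring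
      _ ≤ (L ^ 2 + y ^ 2) * v₁ y ^ 2 * (|a| * (P * sU)) ^ 2 := mul_le_mul_of_nonneg_left h2 (by positivity)
      _ = (|a| * (P * sU)) ^ 2 * ((L ^ 2 + y ^ 2) * v₁ y ^ 2) := by ring
  have hg : Integrable fun y => (L ^ 2 + y ^ 2) * (H y * v y) ^ 2 := by
    refine (hwH.const_mul ((Real.sqrt 2 / L * sEV) ^ 2)).mono' ((by fun_prop : AEStronglyMeasurable (fun y : ℝ => L ^ 2 + y ^ 2) volume).mul
      (hgm.pow 2)) (Eventually.of_forall fun y => ?_)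
    rw [Real.norm_eq_abs, abs_of_nonneg (by positivity)]
    have h2 : v y ^ 2 ≤ (Real.sqrt 2 / L * sEV) ^ 2 := by
      rw [← sq_abs (v y)]; exact pow_le_pow_left₀ (abs_nonneg _) (hV y) 2
    calc (L ^ 2 + y ^ 2) * (H y * v y) ^ 2 = (L ^ 2 + y ^ 2) * H y ^ 2 * v y ^ 2 := by ring
      _ ≤ (L ^ 2 + y ^ 2) * H y ^ 2 * (Real.sqrt 2 / L * sEV) ^ 2 := mul_le_mul_of_nonneg_left h2 (by positivity)
      _ = (Real.sqrt 2 / L * sEV) ^ 2 * ((L ^ 2 + y ^ 2) * H y ^ 2) := by ring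
  -- their weighted norms
  have hfn : Real.sqrt (∫ y, (L ^ 2 + y ^ 2) * (a * U y * v₁ y) ^ 2) ≤ |a| * (P * sU) * sV1 := by
    have hle : ∫ y, (L ^ 2 + y ^ 2) * (a * U y * v₁ y) ^ 2 ≤ (|a| * (P * sU)) ^ 2 * ∫ y, (L ^ 2 + y ^ 2) * v₁ y ^ 2 := by
      rw [← integral_const_mul]
      refine integral_mono hf (hwv₁.const_mul _) fun y => ?_
      have h1 : |a * U y| ≤ |a| * (P * sU) := by rw [abs_mul]; exact mul_le_mul_of_nonneg_left (hU y) (abs_nonneg a)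
      have h2 : (a * U y) ^ 2 ≤ (|a| * (P * sU)) ^ 2 := by
        rw [← sq_abs (a * U y)]; exact pow_le_pow_left₀ (abs_nonneg _) h1 2
      calc (L ^ 2 + y ^ 2) * (a * U y * v₁ y) ^ 2 = (L ^ 2 + y ^ 2) * v₁ y ^ 2 * (a * U y) ^ 2 := by ring
        _ ≤ (L ^ 2 + y ^ 2) * v₁ y ^ 2 * (|a| * (P * sU)) ^ 2 := mul_le_mul_of_nonneg_left h2 (by positivity)
        _ = (|a| * (P * sU)) ^ 2 * ((L ^ 2 + y ^ 2) * v₁ y ^ 2) := by ring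
    calc Real.sqrt (∫ y, (L ^ 2 + y ^ 2) * (a * U y * v₁ y) ^ 2)
        ≤ Real.sqrt ((|a| * (P * sU)) ^ 2 * ∫ y, (L ^ 2 + y ^ 2) * v₁ y ^ 2) := Real.sqrt_le_sqrt hle
      _ = |a| * (P * sU) * sV1 := by
          rw [Real.sqrt_mul (sq_nonneg _), Real.sqrt_sq (mul_nonneg (abs_nonneg a) hCU0)]
  have hgn : Real.sqrt (∫ y, (L ^ 2 + y ^ 2) * (H y * v y) ^ 2) ≤ Real.sqrt 2 / L * sEV * sU := by
    have hle : ∫ y, (L ^ 2 + y ^ 2) * (H y * v y) ^ 2 ≤ (Real.sqrt 2 / L * sEV) ^ 2 * ∫ y, (L ^ 2 + y ^ 2) * H y ^ 2 := by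
      rw [← integral_const_mul]
      refine integral_mono hg (hwH.const_mul _) fun y => ?_
      have h2 : v y ^ 2 ≤ (Real.sqrt 2 / L * sEV) ^ 2 := by
        rw [← sq_abs (v y)]; exact pow_le_pow_left₀ (abs_nonneg _) (hV y) 2
      calc (L ^ 2 + y ^ 2) * (H y * v y) ^ 2 = (L ^ 2 + y ^ 2) * H y ^ 2 * v y ^ 2 := by ring
        _ ≤ (L ^ 2 + y ^ 2) * H y ^ 2 * (Real.sqrt 2 / L * sEV) ^ 2 := mul_le_mul_of_nonneg_left h2 (by positivity)
        _ = (Real.sqrt 2 / L * sEV) ^ 2 * ((L ^ 2 + y ^ 2) * H y ^ 2) := by ring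
    calc Real.sqrt (∫ y, (L ^ 2 + y ^ 2) * (H y * v y) ^ 2)
        ≤ Real.sqrt ((Real.sqrt 2 / L * sEV) ^ 2 * ∫ y, (L ^ 2 + y ^ 2) * H y ^ 2) := Real.sqrt_le_sqrt hle
      _ = Real.sqrt 2 / L * sEV * sU := by rw [Real.sqrt_mul (sq_nonneg _), Real.sqrt_sq hCV0, hiso]
  obtain ⟨hint, hmink⟩ := sqrt_weightedSq_sub_le (L := L) hfm hgm hf hg
  refine ⟨hint, ?_⟩
  calc Real.sqrt (∫ y, (L ^ 2 + y ^ 2) * (a * U y * v₁ y - H y * v y) ^ 2)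
      ≤ Real.sqrt (∫ y, (L ^ 2 + y ^ 2) * (a * U y * v₁ y) ^ 2) + Real.sqrt (∫ y, (L ^ 2 + y ^ 2) * (H y * v y) ^ 2) := hmink
    _ ≤ |a| * (P * sU) * sV1 + Real.sqrt 2 / L * sEV * sU := add_le_add hfn hgn
    _ ≤ |a| * (P * (2 * sEU)) * sEV + Real.sqrt 2 / L * sEV * (2 * sEU) := by gcongr
    _ = (2 * |a| * P + 2 * Real.sqrt 2 / L) * sEU * sEV := by ring

end SheetREnergyClass
end Summit.NavierStokesRegularity.OSWSelfSimilar

end
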